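import Summits.ValiantsHypothesis.ValiantsHypothesis.Theorems.KPlusLogSqLawTropicalCycleMonotone

/-!
# Route «KPlusLogSqLaw», crux `TropicalB` (stmt-ValiantsHypothesis-19771) — THE TWO-TERM TIE LAW: at a breakpoint where exactly two terms
# are optimal, they differ on ONE orbit of their exchange permutation (companion of the cycle potential law)

HONEST FRAMING.  Helper toward the registered stubs `stub_tropThin` / `stub_tropFat` of `Cruxes/TropicalB/Lines/birth.lean` (crux
`Summit.ValiantsHypothesis.ValiantsHypothesis.Theses.KPlusLogSqLaw.TropicalB`, item stmt-ValiantsHypothesis-19771, route KPlusLogSqLaw;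
cell `pub-symmetroid`, seat val-sym-trop-p1 g24, 2026-08-29; `--supports … --as helper`).  A STRUCTURE lemma about two terms of an ARBITRARY
design; it bounds nothing for `TropicalB` and bears on neither `WeakLifting`, DoorA26 / DoorA34, `MatrixDescartes` (stmt-ValiantsHypothesis-18050)
nor VP ≠ VNP.

THE LAW (`agree_on_or_off_of_twoTie`).  Let `q₁ = (σ₁, λ₁) ≠ q₂ = (σ₂, λ₂)` be present terms of a design `(d, v, ε)` that TIE at a slope `θ`
(`w_θ(q₁) = w_θ(q₂)`) while every other present term is strictly lighter at `θ` (a TWO-TERM TIE — the generic breakpoint of a Newton polygon).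
Then for every column set `T` invariant under the quotient `σ₁⁻¹σ₂`, the two terms agree (row AND class) on all of `T` or on all of `Tᶜ`.
Proof: otherwise the exchanged terms `r₁ = (q₂ on T, q₁ off T)`, `r₂ = (q₁ on T, q₂ off T)` (Leibniz terms by invariance,
`exists_perm_restrict` of …TropicalCycleMonotone; present) are both different from `q₁` and `q₂`, hence strictly lighter, while
`w_θ(r₁) + w_θ(r₂) = w_θ(q₁) + w_θ(q₂)` — contradiction.  Corollaries: `changes_in_one_orbit` — all columns where `q₁`, `q₂` differ lie in the
orbit of any one of them (every changed column `b'` is in the same `σ₁⁻¹σ₂`-orbit as a fixed changed column `b₀`); `sameCycle_of_changed`.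

READING (located → explained).  The seat's census reading (py/orbits.py over the tree's kernel certificates (3,5) 28, lex (4,4) 33, tight (4,4) 35,
tight (5,4) 56, GRW (m,4) m = 6..11): EVERY step of EVERY census chain is a single orbit equal to its changed set.  For valuations in general
position every breakpoint is a two-term tie, so consecutive Newton-polygon vertices differ by one orbit (this file); the orbit-size hypothesis of the
cycle potential law (`CyclePotential.chain_le`, …TropicalBCyclePotential) is then a hypothesis on THE cycle of each step.  The normal form
«extremal chains have single-orbit steps» (perturb, rescale slopes, refine) is NOT formalised here.
[this file; exchange construction = …TropicalCycleMonotone (conjb-2 g4 / val-sym-trop-p4 g2)]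
-/

set_option linter.dupNamespace false
set_option autoImplicit false

namespace Summit.ValiantsHypothesis.ValiantsHypothesis.Theorems.KPlusLogSqLaw

open Summit.ValiantsHypothesis.ValiantsHypothesis.Theorems.MatrixDescartes.Negative
open scoped BigOperators
open Finset

namespace CyclePotential

variable {m K : ℕ} (d : Fin K → ℕ) (v ε : Fin m → Fin m → Fin K → ℤ)

/-- every entry of a present term is present. [folklore] -/
theorem entry_present {σ : Equiv.Perm (Fin m)} {l : Fin m → Fin K} (h : termSign ε (σ, l) ≠ 0) (b : Fin m) :
    ε (σ b) b (l b) ≠ 0 := by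
  unfold termSign at h
  exact (Finset.prod_ne_zero_iff.mp (mul_ne_zero_iff.mp h).2) b (Finset.mem_univ _)

/-- a term all of whose entries are present is present. [folklore] -/
theorem present_of_entries (ρ : Equiv.Perm (Fin m)) (k : Fin m → Fin K) (h : ∀ b, ε (ρ b) b (k b) ≠ 0) :
    termSign ε (ρ, k) ≠ 0 := by
  unfold termSign
  refine mul_ne_zero (Units.ne_zero _) ?_
  rw [Finset.prod_ne_zero_iff]
  exact fun b _ => h b

/-- **Exchange identity.**  Exchanging the (row, class) data of two terms on a column set `T` preserves the sum of the two weights at every slope.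
[folklore] -/
theorem tropWeight_exchange_add (θ : ℤ) {σ₁ σ₂ ρ₁ ρ₂ : Equiv.Perm (Fin m)} {l₁ l₂ k₁ k₂ : Fin m → Fin K} (T : Finset (Fin m))
    (hr₁T : ∀ b ∈ T, ρ₁ b = σ₂ b ∧ k₁ b = l₂ b) (hr₁ : ∀ b ∉ T, ρ₁ b = σ₁ b ∧ k₁ b = l₁ b)
    (hr₂T : ∀ b ∈ T, ρ₂ b = σ₁ b ∧ k₂ b = l₁ b) (hr₂ : ∀ b ∉ T, ρ₂ b = σ₂ b ∧ k₂ b = l₂ b) :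
    tropWeight d v θ (ρ₁, k₁) + tropWeight d v θ (ρ₂, k₂) = tropWeight d v θ (σ₁, l₁) + tropWeight d v θ (σ₂, l₂) := by
  unfold tropWeight
  dsimp only
  -- the summand of a term, column by column
  have key : ∀ b : Fin m,
      (θ * (d (k₁ b) : ℤ) - v (ρ₁ b) b (k₁ b)) + (θ * (d (k₂ b) : ℤ) - v (ρ₂ b) b (k₂ b)) =
        (θ * (d (l₁ b) : ℤ) - v (σ₁ b) b (l₁ b)) + (θ * (d (l₂ b) : ℤ) - v (σ₂ b) b (l₂ b)) := by
    intro b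
    by_cases hb : b ∈ T
    · rw [(hr₁T b hb).1, (hr₁T b hb).2, (hr₂T b hb).1, (hr₂T b hb).2]; ring
    · rw [(hr₁ b hb).1, (hr₁ b hb).2, (hr₂ b hb).1, (hr₂ b hb).2]
  have hsum := Finset.sum_congr rfl fun b (_ : b ∈ (univ : Finset (Fin m))) => key b
  simp only [sum_add_distrib, sum_sub_distrib, ← mul_sum] at hsum
  linarith

/-- **TWO-TERM TIE LAW.**  If the present terms `(σ₁, λ₁) ≠ (σ₂, λ₂)` tie at the slope `θ` and every other present term is strictly lighter there,
then on every column set `T` invariant under `σ₁⁻¹σ₂` the two terms agree on all of `T` or on all of `Tᶜ`. [this file] -/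
theorem agree_on_or_off_of_twoTie {θ : ℤ} {σ₁ σ₂ : Equiv.Perm (Fin m)} {l₁ l₂ : Fin m → Fin K}
    (h₁ : termSign ε (σ₁, l₁) ≠ 0) (h₂ : termSign ε (σ₂, l₂) ≠ 0)
    (htie : tropWeight d v θ (σ₁, l₁) = tropWeight d v θ (σ₂, l₂))
    (honly : ∀ q, termSign ε q ≠ 0 → q ≠ (σ₁, l₁) → q ≠ (σ₂, l₂) → tropWeight d v θ q < tropWeight d v θ (σ₁, l₁))
    (T : Finset (Fin m)) (hT : ∀ b, (σ₁⁻¹ * σ₂) b ∈ T ↔ b ∈ T) :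
    (∀ b ∈ T, σ₁ b = σ₂ b ∧ l₁ b = l₂ b) ∨ (∀ b ∉ T, σ₁ b = σ₂ b ∧ l₁ b = l₂ b) := by
  classical
  by_contra hcon
  rw [not_or] at hcon
  obtain ⟨hin, hout⟩ := hcon
  simp only [not_forall, not_and_or, exists_prop] at hin hout
  obtain ⟨b₀, hb₀T, hb₀⟩ := hin
  obtain ⟨b₁, hb₁T, hb₁⟩ := hout
  obtain ⟨πT, hπT, hπT', _⟩ := exists_perm_restrict (σ₁⁻¹ * σ₂) T hT
  -- the exchanged permutations
  set ρ₁ : Equiv.Perm (Fin m) := σ₁ * πT with hρ₁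
  set ρ₂ : Equiv.Perm (Fin m) := σ₂ * πT⁻¹ with hρ₂
  set k₁ : Fin m → Fin K := fun b => if b ∈ T then l₂ b else l₁ b with hk₁
  set k₂ : Fin m → Fin K := fun b => if b ∈ T then l₁ b else l₂ b with hk₂
  have hρ₁T : ∀ b ∈ T, ρ₁ b = σ₂ b ∧ k₁ b = l₂ b := by
    intro b hb
    refine ⟨?_, by simp [hk₁, hb]⟩
    rw [hρ₁, Equiv.Perm.mul_apply, hπT b hb, Equiv.Perm.mul_apply]
    simp
  have hρ₁off : ∀ b ∉ T, ρ₁ b = σ₁ b ∧ k₁ b = l₁ b := by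
    intro b hb
    refine ⟨?_, by simp [hk₁, hb]⟩
    rw [hρ₁, Equiv.Perm.mul_apply, hπT' b hb]
  -- `πT⁻¹` agrees with `(σ₁⁻¹σ₂)⁻¹` on `T` and is the identity off `T`
  have hcancel : ∀ b, (σ₁⁻¹ * σ₂) ((σ₁⁻¹ * σ₂)⁻¹ b) = b := fun b => by
    rw [← Equiv.Perm.mul_apply, mul_inv_cancel, Equiv.Perm.one_apply]
  have hπTinvT : ∀ b ∈ T, πT⁻¹ b = (σ₁⁻¹ * σ₂)⁻¹ b := by
    intro b hb
    have hmem : (σ₁⁻¹ * σ₂)⁻¹ b ∈ T := by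
      have h := hT ((σ₁⁻¹ * σ₂)⁻¹ b)
      rw [hcancel] at h
      exact h.mp hb
    rw [Equiv.Perm.inv_eq_iff_eq, hπT _ hmem, hcancel]
  have hπTinv_off : ∀ b ∉ T, πT⁻¹ b = b := by
    intro b hb
    rw [Equiv.Perm.inv_eq_iff_eq, hπT' b hb]
  have hρ₂T : ∀ b ∈ T, ρ₂ b = σ₁ b ∧ k₂ b = l₁ b := by
    intro b hb
    refine ⟨?_, by simp [hk₂, hb]⟩
    rw [hρ₂, Equiv.Perm.mul_apply, hπTinvT b hb]
    simp [Equiv.Perm.mul_apply]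
  have hρ₂off : ∀ b ∉ T, ρ₂ b = σ₂ b ∧ k₂ b = l₂ b := by
    intro b hb
    refine ⟨?_, by simp [hk₂, hb]⟩
    rw [hρ₂, Equiv.Perm.mul_apply, hπTinv_off b hb]
  -- presence of the exchanged terms
  have hp₁ := entry_present ε h₁
  have hp₂ := entry_present ε h₂
  have hr₁pres : termSign ε (ρ₁, k₁) ≠ 0 := by
    refine present_of_entries ε ρ₁ k₁ fun b => ?_
    by_cases hb : b ∈ T
    · rw [(hρ₁T b hb).1, (hρ₁T b hb).2]; exact hp₂ b
    · rw [(hρ₁off b hb).1, (hρ₁off b hb).2]; exact hp₁ b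
  have hr₂pres : termSign ε (ρ₂, k₂) ≠ 0 := by
    refine present_of_entries ε ρ₂ k₂ fun b => ?_
    by_cases hb : b ∈ T
    · rw [(hρ₂T b hb).1, (hρ₂T b hb).2]; exact hp₁ b
    · rw [(hρ₂off b hb).1, (hρ₂off b hb).2]; exact hp₂ b
  -- the exchanged terms differ from both `q₁` and `q₂`
  have hdiff : ∀ {ρ : Equiv.Perm (Fin m)} {k : Fin m → Fin K} {σ : Equiv.Perm (Fin m)} {l : Fin m → Fin K} (b : Fin m),
      (ρ b ≠ σ b ∨ k b ≠ l b) → (ρ, k) ≠ (σ, l) := by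
    intro ρ k σ l b hb h
    have hρ : ρ = σ := congrArg Prod.fst h
    have hk : k = l := congrArg Prod.snd h
    rcases hb with hb | hb
    · exact hb (by rw [hρ])
    · exact hb (by rw [hk])
  have hr₁ne₁ : (ρ₁, k₁) ≠ (σ₁, l₁) := by
    refine hdiff b₀ ?_
    rw [(hρ₁T b₀ hb₀T).1, (hρ₁T b₀ hb₀T).2]
    rcases hb₀ with h | h
    · exact Or.inl (Ne.symm h)
    · exact Or.inr (Ne.symm h)
  have hr₁ne₂ : (ρ₁, k₁) ≠ (σ₂, l₂) := by
    refine hdiff b₁ ?_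
    rw [(hρ₁off b₁ hb₁T).1, (hρ₁off b₁ hb₁T).2]
    exact hb₁
  have hr₂ne₁ : (ρ₂, k₂) ≠ (σ₁, l₁) := by
    refine hdiff b₁ ?_
    rw [(hρ₂off b₁ hb₁T).1, (hρ₂off b₁ hb₁T).2]
    rcases hb₁ with h | h
    · exact Or.inl (Ne.symm h)
    · exact Or.inr (Ne.symm h)
  have hr₂ne₂ : (ρ₂, k₂) ≠ (σ₂, l₂) := by
    refine hdiff b₀ ?_
    rw [(hρ₂T b₀ hb₀T).1, (hρ₂T b₀ hb₀T).2]
    exact hb₀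
  have hA := honly _ hr₁pres hr₁ne₁ hr₁ne₂
  have hB := honly _ hr₂pres hr₂ne₁ hr₂ne₂
  have hadd := tropWeight_exchange_add d v θ T hρ₁T hρ₁off hρ₂T hρ₂off
  linarith

/-- **All changes lie in one orbit.**  Under a two-term tie, every column where the terms differ lies in the `σ₁⁻¹σ₂`-invariant closure of any
other such column: if `T` is invariant and contains one changed column, it contains all of them. [this file] -/
theorem changes_in_one_orbit {θ : ℤ} {σ₁ σ₂ : Equiv.Perm (Fin m)} {l₁ l₂ : Fin m → Fin K}
    (h₁ : termSign ε (σ₁, l₁) ≠ 0) (h₂ : termSign ε (σ₂, l₂) ≠ 0)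
    (htie : tropWeight d v θ (σ₁, l₁) = tropWeight d v θ (σ₂, l₂))
    (honly : ∀ q, termSign ε q ≠ 0 → q ≠ (σ₁, l₁) → q ≠ (σ₂, l₂) → tropWeight d v θ q < tropWeight d v θ (σ₁, l₁))
    (T : Finset (Fin m)) (hT : ∀ b, (σ₁⁻¹ * σ₂) b ∈ T ↔ b ∈ T)
    {b₀ : Fin m} (hb₀T : b₀ ∈ T) (hb₀ : σ₁ b₀ ≠ σ₂ b₀ ∨ l₁ b₀ ≠ l₂ b₀)
    (b : Fin m) (hb : σ₁ b ≠ σ₂ b ∨ l₁ b ≠ l₂ b) : b ∈ T := by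
  rcases agree_on_or_off_of_twoTie d v ε h₁ h₂ htie honly T hT with h | h
  · exact absurd (h b₀ hb₀T) (by rcases hb₀ with hh | hh <;> simp [hh])
  · by_contra hbT
    exact absurd (h b hbT) (by rcases hb with hh | hh <;> simp [hh])

open Classical in
/-- **Orbit form.**  Under a two-term tie, any two columns where the terms differ are in the same cycle of `σ₁⁻¹σ₂`. [this file] -/
theorem sameCycle_of_changed {θ : ℤ} {σ₁ σ₂ : Equiv.Perm (Fin m)} {l₁ l₂ : Fin m → Fin K}
    (h₁ : termSign ε (σ₁, l₁) ≠ 0) (h₂ : termSign ε (σ₂, l₂) ≠ 0)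
    (htie : tropWeight d v θ (σ₁, l₁) = tropWeight d v θ (σ₂, l₂))
    (honly : ∀ q, termSign ε q ≠ 0 → q ≠ (σ₁, l₁) → q ≠ (σ₂, l₂) → tropWeight d v θ q < tropWeight d v θ (σ₁, l₁))
    {b₀ b : Fin m} (hb₀ : σ₁ b₀ ≠ σ₂ b₀ ∨ l₁ b₀ ≠ l₂ b₀) (hb : σ₁ b ≠ σ₂ b ∨ l₁ b ≠ l₂ b) :
    (σ₁⁻¹ * σ₂).SameCycle b₀ b := by
  have hT : ∀ x, (σ₁⁻¹ * σ₂) x ∈ (univ.filter fun x : Fin m => (σ₁⁻¹ * σ₂).SameCycle b₀ x) ↔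
      x ∈ (univ.filter fun x : Fin m => (σ₁⁻¹ * σ₂).SameCycle b₀ x) := by
    intro x
    simp only [mem_filter, mem_univ, true_and]
    exact Equiv.Perm.sameCycle_apply_right
  have h := changes_in_one_orbit d v ε h₁ h₂ htie honly _ hT
    (mem_filter.mpr ⟨mem_univ _, Equiv.Perm.SameCycle.refl _ b₀⟩) hb₀ b hb
  exact (mem_filter.mp h).2

end CyclePotential

end Summit.ValiantsHypothesis.ValiantsHypothesis.Theorems.KPlusLogSqLaw
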